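import Summits.ResolutionOfSingularities.ResolutionOfSingularities.Theses.DefectlessFrames
import Literature.AlgebraicGeometry.Resolution.ResolutionLU
import Literature.Barriers.ResolutionOfSingularities.InseparableBaseChange

/-!
# Disproof of `ResidueTranscendenceReduction` — findings

Crux `DefectlessFrames.ResidueTranscendenceReduction` (stmt-ResolutionOfSingularities-18875, rank 4):
`∀ p prime, HypA p → ConcB p`, where `HypA p` = relative local uniformization at every RANK-ONE,
ZERO-DIMENSIONAL valuation ring over every PERFECT field of characteristic `p` (all f.g. `K/k`), and
`ConcB p` = relative local uniformization at EVERY valuation ring over every perfect field of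
characteristic `p` (verbatim the antecedent of `PatchingRelPerfect`).

Findings (cycle 1, refuter-cdisprove):

1. SANDWICH (§1, proved): `ConcB p` follows from `ResolutionInChar p` (tree
   `lurel_of_resolutionInChar`), hence `ResolutionOfSingularities → ResidueTranscendenceReduction` and
   `¬ ResidueTranscendenceReduction → ¬ ResolutionOfSingularities`.  An unconditional refutation of this
   crux is a refutation of the summit; none is attempted beyond typing checks.  Conversely `HypA p` is a
   literal special case of `ConcB p` (§1, `hypA_of_concB`), so the crux is exactly "the special case
   implies the general case".
2. LOAD-BEARING ANALYSIS (§2): the crux has only two top-level hypotheses, `p.Prime` and `HypA p`.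
   `_false_without_HypA` would be `¬ ConcB p` (= ¬ summit), `_false_without_prime` would need the
   characteristic-0 case, and dropping any hypothesis INSIDE `ConcB` (e.g. `K/k` f.g.) yields a variant
   whose negation is `HypA p ∧ ¬ ConcB' p` — it needs `HypA p`, i.e. local uniformization itself.  So no
   `_false_without_` lemma is available for this implication-shaped crux; recorded as `Iff` lemmas.
3. RANGE (§3, proved; LANDED p150464 as Theorems/ResidueTranscendenceReduction/Negative/ConclusionRangeExceedsHypothesis,
   and the rank-one instance §4b `RankOne.exists_rankOne_conclusion_instance_not_zeroDim`): the conclusion quantifies over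
   valuation rings that are neither rank one nor zero-dimensional (witness: the trivial valuation ring of
   `𝔽_p(t)`), so the crux is not closed by specialising `HypA`.
4. NATURAL STRENGTHENING REFUTED (§4, proved; LANDED p150462 Negative/NotPerfectRebase and p150463
   Negative/NotPerfectRebaseRankOne): Zariski's
   residue-transcendence reduction (Zariski 1940 C.IV §9: adjoin lifts `ξ` of a residue transcendence
   basis to the ground field, `k' = k(ξ)`, making `O` zero-dimensional over `k'`) CANNOT be run inside
   perfect ground fields: `PerfectRebase` is false.  Mechanism: a perfect intermediate field `k ⊆ k' ⊆ K`
   of a finitely generated extension of a perfect field is algebraic over `k` (it lies in `⋂ₙ K^{pⁿ}`),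
   so `O` is zero-dimensional over `k'` only if it already is over `k`.  Typed witness: `K = 𝔽_p(t)`,
   `O = ⊤` (residue field `𝔽_p(t)`): a perfect `k'` with `K/k'` algebraic would make `K` perfect
   (`Algebra.IsAlgebraic.perfectField`), but `t` is not a `p`-th power (`ratFuncX_ne_pow`).  RANK-ONE
   FORM TYPED TOO (§4b, `RankOne.not_perfectRebase_rankOne`, landed as Negative/NotPerfectRebaseRankOne):
   `K = 𝔽_p(s)(t)`, `O` the `t`-adic ring (discrete, rank one, residue field `𝔽_p(s)`) — the open
   dimension-half situation itself — admits no perfect `k' ⊆ O` over which it is zero-dimensional; general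
   mechanism `RankOne.exists_pow_sub_mem_nonunits_of_perfect`: residue algebraic over the residue image of a
   perfect subfield ⇒ residue is a `p`-th power.  GENERAL THEOREM TYPED (§4c, LANDED p150917 as
   Negative/ZeroDimOverPerfectRebase): perfect intermediate fields of f.g. extensions are algebraic over the
   base, so zero-dimensional over a perfect `k' ⊆ O` ⇒ zero-dimensional over `k` — rebasing inside `K` is
   useless in general, not only at the two witnesses.
5. WHY IT RESISTS / WHERE A PROOF MUST GO (informal, §5 docstrings): with perfect rebasing excluded and
   composite valuations raising the rank (NS2014 returns the SAME rank-one piece), `HypA` can only be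
   brought to bear on a positive-dimensional rank-one `O` through an auxiliary valued function field over
   a perfect transcendental extension `k'' = k(u)^{perf}` of `k` (e.g. `K'' = K(u^{1/p^∞})`, `u ↦ ξ + t`),
   followed by a DESCENT of regularity along `K(u^{1/pⁿ}) ⊋ K` — the territory of the catalogued
   barriers `InseparableBaseChange` / `InseparableBaseChangeResolution` (regularity is not stable under
   inseparable ground-field extension).  Dropping `PerfectField k` from `HypA` (zero-dimensional rank-one
   LU over ALL ground fields) would make the crux Zariski's device + `NovacoskiSpivakovsky2014_holds`.
-/

set_option linter.dupNamespace false -- mandated namespace of this single-conjunct summit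

namespace Summit.ResolutionOfSingularities.ResolutionOfSingularities.Cruxes.ResidueTranscendenceReduction.Disproof

open Summit.ResolutionOfSingularities.ResolutionOfSingularities.Theses.DefectlessFrames
open scoped Polynomial IntermediateField
open IsDedekindDomain.HeightOneSpectrum

/-! ## §0 The two halves of the crux, named -/

/-- `HypA p`: the hypothesis of the crux at `p` — relative local uniformization at all rank-one
zero-dimensional valuation rings over perfect fields of characteristic `p` (verbatim). -/
def HypA (p : ℕ) : Prop :=
  ∀ (k K : Type) [Field k] [CharP k p] [PerfectField k] [Field K] [Algebra k K],
    (⊤ : IntermediateField k K).FG → ∀ O : ValuationSubring K, (∀ c : k, algebraMap k K c ∈ O) →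
      Nonempty O.valuation.RankOne →
        (∀ x ∈ O, ∃ f : Polynomial k, f ≠ 0 ∧ Polynomial.aeval x f ∈ O.nonunits) →
          ∀ R : Subalgebra k K, R.FG → R.toSubring ≤ O.toSubring →
            ∃ (A : Subalgebra k K) (h : A.toSubring ≤ O.toSubring), R ≤ A ∧ A.FG ∧
              IsFractionRing A K ∧ IsRegularLocalRing (Localization.AtPrime
                (Ideal.comap (Subring.inclusion h) (IsLocalRing.maximalIdeal O)))

/-- `ConcB p`: the conclusion of the crux at `p` — relative local uniformization at ALL valuation
rings over perfect fields of characteristic `p` (verbatim; = antecedent of `PatchingRelPerfect p`). -/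
def ConcB (p : ℕ) : Prop :=
  ∀ (k K : Type) [Field k] [CharP k p] [PerfectField k] [Field K] [Algebra k K],
    (⊤ : IntermediateField k K).FG → ∀ O : ValuationSubring K, (∀ c : k, algebraMap k K c ∈ O) →
      ∀ R : Subalgebra k K, R.FG → R.toSubring ≤ O.toSubring →
        ∃ (A : Subalgebra k K) (h : A.toSubring ≤ O.toSubring), R ≤ A ∧ A.FG ∧
          IsFractionRing A K ∧ IsRegularLocalRing (Localization.AtPrime
            (Ideal.comap (Subring.inclusion h) (IsLocalRing.maximalIdeal O)))

/-- The crux is literally `∀ p prime, HypA p → ConcB p`. -/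
theorem rr_iff : ResidueTranscendenceReduction ↔ ∀ p : ℕ, p.Prime → HypA p → ConcB p := Iff.rfl

/-! ## §1 Sandwich: the conclusion follows from the summit; the hypothesis is a special case -/

/-- `ConcB p` from resolution in characteristic `p` (tree `lurel_of_resolutionInChar`, which does not
even need `PerfectField k`). -/
theorem concB_of_resolutionInChar (p : ℕ) (hp : p.Prime)
    (h : Literature.AlgebraicGeometry.Resolution.ResolutionInChar.{0} p) : ConcB p := by
  intro k K _ _ _ _ _ hfg O hk R hR hRO
  exact Literature.AlgebraicGeometry.Resolution.lurel_of_resolutionInChar p hp h k K hfg O hk R hR hRO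

/-- The summit implies the crux (CONDITIONAL on the summit — settles nothing; it shows the crux is
consistent relative to the summit; same content as `s_to_c` in the rattack evidence RRProbes.lean). -/
theorem rr_of_summit (hS : _root_.ResolutionOfSingularities) : ResidueTranscendenceReduction :=
  fun p hp _ => concB_of_resolutionInChar p hp (hS p hp)

/-- Contrapositive: any refutation of this crux refutes the summit `ResolutionOfSingularities`. -/
theorem not_summit_of_not_rr (h : ¬ ResidueTranscendenceReduction) :
    ¬ _root_.ResolutionOfSingularities :=
  fun hS => h (rr_of_summit hS)

/-- `HypA p` is a literal special case of `ConcB p` (drop the rank-one and zero-dimensionality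
hypotheses), so the crux says exactly "the special case implies the general case". -/
theorem hypA_of_concB {p : ℕ} (h : ConcB p) : HypA p :=
  fun k K _ _ _ _ _ hfg O hk _ _ R hR hRO => h k K hfg O hk R hR hRO

/-- Hence, pointwise in `p`, the crux is the equivalence of its two halves. -/
theorem rr_iff_hypA_iff_concB :
    ResidueTranscendenceReduction ↔ ∀ p : ℕ, p.Prime → (HypA p ↔ ConcB p) :=
  ⟨fun h p hp => ⟨h p hp, hypA_of_concB⟩, fun h p hp => (h p hp).mp⟩

/-! ## §2 Load-bearing analysis: why no `_false_without_` lemma exists for this crux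

For an implication-shaped crux `HypA p → ConcB p` every "drop a hypothesis inside the conclusion"
variant `HypA p → ConcB' p` has negation `HypA p ∧ ¬ ConcB' p`: refuting it needs `HypA p`, i.e. local
uniformization at rank-one zero-dimensional valuations in every dimension (open from dimension 4).
The two lemmas below are the bookkeeping; they are tautologies, recorded so that later seats do not
re-derive them. -/

/-- Negating a weakened crux needs the hypothesis `HypA p` itself. -/
theorem not_imp_variant_iff {p : ℕ} (ConcB' : Prop) :
    ¬ (HypA p → ConcB') ↔ (HypA p ∧ ¬ ConcB') := Classical.not_imp

/-- Negating the crux itself needs `HypA p ∧ ¬ ConcB p` at some prime, and `¬ ConcB p` already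
contradicts `ResolutionInChar p` (`concB_of_resolutionInChar`). -/
theorem not_rr_iff : ¬ ResidueTranscendenceReduction ↔ ∃ p : ℕ, p.Prime ∧ HypA p ∧ ¬ ConcB p := by
  simp only [rr_iff, Classical.not_forall, exists_prop]

/-! ## §3 The conclusion ranges over valuation rings outside the hypothesis' range -/

section Witness

variable (p : ℕ) [hp : Fact p.Prime]

/-- The witness field `𝔽_p(t)` (= `Literature.Barriers.…​.baseField p`). -/
abbrev Kt : Type := RatFunc (ZMod p)

instance : CharP (Kt p) p :=
  charP_of_injective_algebraMap (algebraMap (ZMod p) (Kt p)).injective p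

/-- `𝔽_p(t) = 𝔽_p(t)`: the top intermediate field is generated by `t`. -/
theorem adjoin_X_eq_top : IntermediateField.adjoin (ZMod p) {(RatFunc.X : Kt p)} = ⊤ := by
  rw [eq_top_iff]
  intro x _
  rw [← RatFunc.num_div_denom x]
  refine div_mem ?_ ?_
  · rw [← RatFunc.aeval_X_left_eq_algebraMap]
    exact IntermediateField.algebra_adjoin_le_adjoin _ _ (Polynomial.aeval_mem_adjoin_singleton _ _)
  · rw [← RatFunc.aeval_X_left_eq_algebraMap]
    exact IntermediateField.algebra_adjoin_le_adjoin _ _ (Polynomial.aeval_mem_adjoin_singleton _ _)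

theorem fg_top : (⊤ : IntermediateField (ZMod p) (Kt p)).FG := by
  rw [← adjoin_X_eq_top p]
  simpa using IntermediateField.fg_adjoin_finset ({RatFunc.X} : Finset (Kt p))

/-- On the trivial valuation ring every non-zero element has valuation `1`. -/
theorem valuation_top_eq_one {K : Type} [Field K] {x : K} (hx : x ≠ 0) :
    (⊤ : ValuationSubring K).valuation x = 1 := by
  have hnt : ¬ (⊤ : ValuationSubring K).valuation.IsNontrivial :=
    (ValuationSubring.eq_top_iff (⊤ : ValuationSubring K)).mp rfl
  by_contra h1
  exact hnt ⟨x, ((⊤ : ValuationSubring K).valuation.ne_zero_iff).mpr hx, h1⟩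

/-- Membership in the non-units of the trivial valuation ring means being zero. -/
theorem mem_nonunits_top_iff {K : Type} [Field K] (x : K) :
    x ∈ (⊤ : ValuationSubring K).nonunits ↔ x = 0 := by
  rw [ValuationSubring.mem_nonunits_iff]
  refine ⟨fun h => ?_, fun h => by simp [h]⟩
  by_contra hx
  have h1 : (⊤ : ValuationSubring K).valuation x = 1 := valuation_top_eq_one hx
  rw [h1] at h
  exact lt_irrefl _ h

/-- The trivial valuation ring carries no rank-one structure (rank one entails non-triviality). -/
theorem not_rankOne_top {K : Type} [Field K] :
    ¬ Nonempty (⊤ : ValuationSubring K).valuation.RankOne := by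
  rintro ⟨hr⟩
  exact (ValuationSubring.eq_top_iff (⊤ : ValuationSubring K)).mp rfl hr.toIsNontrivial

/-- The trivial valuation ring of `𝔽_p(t)` is not zero-dimensional over `𝔽_p`: its residue field is
`𝔽_p(t)`, and `t` is transcendental. -/
theorem not_zeroDim_top :
    ¬ (∀ x ∈ (⊤ : ValuationSubring (Kt p)), ∃ f : Polynomial (ZMod p), f ≠ 0 ∧
        Polynomial.aeval x f ∈ (⊤ : ValuationSubring (Kt p)).nonunits) := by
  intro h
  obtain ⟨f, hf0, hf⟩ := h RatFunc.X (ValuationSubring.mem_top _)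
  rw [mem_nonunits_top_iff, RatFunc.aeval_X_left_eq_algebraMap] at hf
  exact hf0 (RatFunc.algebraMap_injective (ZMod p) (by simpa using hf))

/-- **RANGE LEMMA.** The conclusion of the crux quantifies over valuation rings that are neither rank
one nor zero-dimensional — so `ResidueTranscendenceReduction` is not closed by specialising its
hypothesis (`fun p hp hA k K … O hk => hA k K … O hk _ _` has unfillable holes).  Witness: the trivial
valuation ring of `𝔽_p(t)` over `𝔽_p` (perfect, `K/k` finitely generated, `k ⊆ O`). -/
theorem exists_conclusion_instance_outside_hypothesis :
    ∃ (k K : Type) (_ : Field k) (_ : CharP k p) (_ : PerfectField k) (_ : Field K) (_ : Algebra k K)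
      (O : ValuationSubring K), (⊤ : IntermediateField k K).FG ∧ (∀ c : k, algebraMap k K c ∈ O) ∧
        ¬ Nonempty O.valuation.RankOne ∧
        ¬ (∀ x ∈ O, ∃ f : Polynomial k, f ≠ 0 ∧ Polynomial.aeval x f ∈ O.nonunits) :=
  ⟨ZMod p, Kt p, inferInstance, inferInstance, PerfectField.ofFinite, inferInstance, inferInstance, ⊤,
    fg_top p, fun _ => ValuationSubring.mem_top _, not_rankOne_top, not_zeroDim_top p⟩

/-! ## §4 Natural strengthening refuted: no perfect rebasing (Zariski C.IV §9 inside perfect fields) -/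

/-- NATURAL STRENGTHENING `PerfectRebase` (the device a direct proof of the dimension half would use):
every valuation ring `O ⊇ k` of a finitely generated extension `K` of a perfect field `k` of
characteristic `p` admits a PERFECT intermediate ground field `k ⊆ k' ⊆ O` over which `O` is
zero-dimensional (residue field algebraic over `k'`) — so that, after Novacoski–Spivakovsky rank
reduction, `HypA p` would apply to `(k', K, O)` directly.  Zariski's `k' = k(ξ)` (lifts of a residue
transcendence basis) does this with an IMPERFECT `k'`; the perfect version is false (next theorem). -/
def PerfectRebase : Prop :=
  ∀ p : ℕ, p.Prime → ∀ (k K : Type) [Field k] [CharP k p] [PerfectField k] [Field K] [Algebra k K],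
    (⊤ : IntermediateField k K).FG → ∀ O : ValuationSubring K, (∀ c : k, algebraMap k K c ∈ O) →
      ∃ k' : IntermediateField k K, (∀ c : k', (c : K) ∈ O) ∧ PerfectField k' ∧
        ∀ x ∈ O, ∃ f : Polynomial k', f ≠ 0 ∧ Polynomial.aeval x f ∈ O.nonunits

/-- Over the trivial valuation ring of `𝔽_p(t)`, no perfect intermediate field makes it
zero-dimensional: `K/k'` algebraic with `k'` perfect forces `K = 𝔽_p(t)` perfect
(`Algebra.IsAlgebraic.perfectField`), but `t` is not a `p`-th power (`ratFuncX_ne_pow`). -/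
theorem not_exists_perfect_zeroDim_top :
    ¬ ∃ k' : IntermediateField (ZMod p) (Kt p), PerfectField k' ∧
        ∀ x ∈ (⊤ : ValuationSubring (Kt p)), ∃ f : Polynomial k', f ≠ 0 ∧
          Polynomial.aeval x f ∈ (⊤ : ValuationSubring (Kt p)).nonunits := by
  rintro ⟨k', hperf, hzd⟩
  haveI := hperf
  have halg : Algebra.IsAlgebraic k' (Kt p) := by
    refine ⟨fun x => ?_⟩
    obtain ⟨f, hf0, hf⟩ := hzd x (ValuationSubring.mem_top _)
    rw [mem_nonunits_top_iff] at hf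
    exact ⟨f, hf0, hf⟩
  haveI : PerfectField (Kt p) := Algebra.IsAlgebraic.perfectField k'
  haveI : ExpChar (Kt p) p := ExpChar.prime hp.out
  haveI : PerfectRing (Kt p) p := PerfectField.toPerfectRing p
  obtain ⟨b, hb⟩ := (frobeniusEquiv (Kt p) p).surjective RatFunc.X
  exact Literature.Barriers.ResolutionOfSingularities.ratFuncX_ne_pow p b (by simpa [frobeniusEquiv, frobenius] using hb)

end Witness

/-- **`PerfectRebase` is false** (witness `p = 2`, `k = 𝔽₂`, `K = 𝔽₂(t)`, `O = ⊤`).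
GENERAL MECHANISM (paper proof, not typed here): if `k` is perfect of characteristic `p` and `K/k` is
finitely generated, every perfect intermediate field `k'` lies in `⋂ₙ K^{pⁿ}` and is therefore
algebraic over `k`; hence `O` is zero-dimensional over a perfect `k' ⊆ O` iff it is zero-dimensional
over `k`.  RANK-ONE FORM (same computation one level up): `K = 𝔽_p(s)(t)`, `O` the `t`-adic valuation
ring (discrete, rank one, residue field `𝔽_p(s)` transcendental over `𝔽_p`); a perfect `k' ⊆ O` with
`s̄` algebraic over the residue image of `k'` would make `s` a `p`-th power in `𝔽_p(s)`.  CONSEQUENCE for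
provers: `HypA p` is never applicable to a positive-dimensional valuation ring of the SAME valued field
under any admissible (perfect) change of ground field; any proof of the dimension half must pass
through an auxiliary valued function field (ground field `k(u)^{perf}`, function field `K(u^{1/p^∞})`)
and descend regularity along `K(u^{1/pⁿ})/K`. -/
theorem not_perfectRebase : ¬ PerfectRebase := by
  intro h
  haveI : Fact (Nat.Prime 2) := ⟨Nat.prime_two⟩
  haveI : PerfectField (ZMod 2) := PerfectField.ofFinite
  obtain ⟨k', -, hperf, hzd⟩ :=
    h 2 Nat.prime_two (ZMod 2) (Kt 2) (fg_top 2) ⊤ (fun _ => ValuationSubring.mem_top _)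
  exact not_exists_perfect_zeroDim_top 2 ⟨k', hperf, hzd⟩

/-! ## §4b The rank-one form: no perfect rebasing at a rank-one (discrete) place

Same mechanism one level up (mirrors `Theorems/ResidueTranscendenceReduction/Negative/NotPerfectRebaseRankOne.lean`,
landed p150463 `--supports` this crux): `K = 𝔽_p(s)(t)`, `O` the `t`-adic valuation ring — rank one, residue field
`𝔽_p(s)` transcendental over `𝔽_p`, i.e. exactly the open DIMENSION-HALF situation — admits no perfect
intermediate ground field over which it is zero-dimensional. -/

namespace RankOne

/-! ## The residue-field mechanism (general valuation rings) -/

/-- If `x ∈ O` has residue ALGEBRAIC over the residue image of a PERFECT subfield `k' ⊆ O` (this is what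
"`O` zero-dimensional over `k'`" says about `x`), then the residue of `x` is a `p`-th power: there is
`Y ∈ O` with `Y^p − x` in the maximal ideal.  (The residue image `L` of `k'` is perfect, `L(x̄)` is an
algebraic extension of a perfect field, hence perfect.) [folklore] -/
theorem exists_pow_sub_mem_nonunits_of_perfect {k K : Type} [Field k] [Field K] [Algebra k K]
    (p : ℕ) [hp : Fact p.Prime] [CharP K p] (O : ValuationSubring K) (k' : IntermediateField k K)
    (hk' : ∀ c : k', (c : K) ∈ O) [PerfectField k'] {x : K} (hx : x ∈ O)
    (halg : ∃ f : Polynomial k', f ≠ 0 ∧ Polynomial.aeval x f ∈ O.nonunits) :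
    ∃ Y ∈ O, Y ^ p - x ∈ O.nonunits := by
  classical
  obtain ⟨f, hf0, hf⟩ := halg
  -- the inclusion `k' → O` and its composite with the residue map
  let φ : k' →+* O := (algebraMap k' K).codRestrict O (fun c => hk' c)
  let κ := IsLocalRing.ResidueField O
  let ψ : k' →+* κ := (IsLocalRing.residue O).comp φ
  haveI : CharP k' p := ((algebraMap k' K).charP_iff_charP p).mpr inferInstance
  haveI : CharP κ p := (ψ.charP_iff_charP p).mp inferInstance
  haveI : ExpChar k' p := ExpChar.prime hp.out
  haveI : ExpChar κ p := ExpChar.prime hp.out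
  haveI : PerfectRing k' p := PerfectField.toPerfectRing p
  -- the residue image `L` of `k'` is perfect
  let L : Subfield κ := ψ.fieldRange
  haveI : CharP L p := ((algebraMap L κ).charP_iff_charP p).mpr inferInstance
  haveI : ExpChar L p := ExpChar.prime hp.out
  haveI : PerfectRing L p := by
    refine PerfectRing.ofSurjective L p fun y => ?_
    obtain ⟨c, hc⟩ := ψ.mem_fieldRange.mp y.2
    obtain ⟨d, rfl⟩ := surjective_frobenius k' p c
    refine ⟨⟨ψ d, ψ.mem_fieldRange.mpr ⟨d, rfl⟩⟩, Subtype.ext ?_⟩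
    simp [frobenius_def, ← hc]
  haveI : PerfectField L := PerfectRing.toPerfectField L p
  -- the residue `x̄` of `x` is a root of `f` pushed to the residue field
  let xO : O := ⟨x, hx⟩
  let xbar : κ := IsLocalRing.residue O xO
  have hcoe : ((Polynomial.eval₂ φ xO f : O) : K) = Polynomial.aeval x f := by
    rw [show ((Polynomial.eval₂ φ xO f : O) : K) = O.subtype (Polynomial.eval₂ φ xO f) from rfl,
      Polynomial.hom_eval₂, Polynomial.aeval_def]
    rfl
  have hroot : Polynomial.eval₂ ψ xbar f = 0 := by
    have h1 : Polynomial.eval₂ ψ xbar f = IsLocalRing.residue O (Polynomial.eval₂ φ xO f) := by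
      rw [Polynomial.hom_eval₂]
    rw [h1, IsLocalRing.residue_eq_zero_iff, ValuationSubring.valuation_lt_one_iff, hcoe,
      ← ValuationSubring.mem_nonunits_iff]
    exact hf
  have halgL : IsAlgebraic L xbar := by
    refine ⟨f.map ψ.rangeRestrictField, (Polynomial.map_ne_zero_iff ψ.rangeRestrictField.injective).mpr hf0,
      ?_⟩
    rw [Polynomial.aeval_def, Polynomial.eval₂_map]
    exact hroot
  -- `L(x̄)` is perfect, so `x̄` is a `p`-th power in the residue field
  haveI : FiniteDimensional L L⟮xbar⟯ := IntermediateField.adjoin.finiteDimensional halgL.isIntegral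
  haveI : Algebra.IsAlgebraic L L⟮xbar⟯ := Algebra.IsAlgebraic.of_finite L _
  haveI : PerfectField L⟮xbar⟯ := Algebra.IsAlgebraic.perfectField L
  haveI : CharP L⟮xbar⟯ p := ((algebraMap L⟮xbar⟯ κ).charP_iff_charP p).mpr inferInstance
  haveI : ExpChar L⟮xbar⟯ p := ExpChar.prime hp.out
  haveI : PerfectRing L⟮xbar⟯ p := PerfectField.toPerfectRing p
  obtain ⟨z, hz⟩ := surjective_frobenius L⟮xbar⟯ p ⟨xbar, IntermediateField.mem_adjoin_simple_self L xbar⟩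
  have hz' : ((z : κ)) ^ p = xbar := by
    have := congrArg (fun w : L⟮xbar⟯ => (w : κ)) hz
    simpa [frobenius_def] using this
  -- lift `z` to `O`
  obtain ⟨Y, hY⟩ := Ideal.Quotient.mk_surjective (I := IsLocalRing.maximalIdeal O) (z : κ)
  have hY' : IsLocalRing.residue O Y = (z : κ) := hY
  refine ⟨(Y : K), Y.2, ?_⟩
  have hcoe2 : (Y : K) ^ p - x = ((Y ^ p - xO : O) : K) := by push_cast; rfl
  rw [ValuationSubring.mem_nonunits_iff, hcoe2, ← ValuationSubring.valuation_lt_one_iff,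
    ← IsLocalRing.residue_eq_zero_iff, map_sub, map_pow, hY', hz']
  exact sub_self _

/-- **Zero-dimensional over a perfect subfield ⇒ perfect residue field.** If every element of a valuation
ring `O` has residue algebraic over the residue image of a PERFECT subfield `k' ⊆ O`, then the residue field
of `O` is perfect (it is an algebraic extension of the perfect field `k̄'`).  Contrapositive, for provers: a
valuation ring whose residue field is imperfect (e.g. finitely generated and transcendental over a perfect
`k`, such as `𝔽_p(s)`) is zero-dimensional over NO perfect subfield. [folklore] -/
theorem perfectField_residueField_of_zeroDim_perfect {k K : Type} [Field k] [Field K] [Algebra k K]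
    (p : ℕ) [hp : Fact p.Prime] [CharP K p] (O : ValuationSubring K) (k' : IntermediateField k K)
    (hk' : ∀ c : k', (c : K) ∈ O) [PerfectField k']
    (hzd : ∀ x ∈ O, ∃ f : Polynomial k', f ≠ 0 ∧ Polynomial.aeval x f ∈ O.nonunits) :
    PerfectField (IsLocalRing.ResidueField O) := by
  classical
  let φ : k' →+* O := (algebraMap k' K).codRestrict O (fun c => hk' c)
  let κ := IsLocalRing.ResidueField O
  let ψ : k' →+* κ := (IsLocalRing.residue O).comp φ
  haveI : CharP k' p := ((algebraMap k' K).charP_iff_charP p).mpr inferInstance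
  haveI : CharP κ p := (ψ.charP_iff_charP p).mp inferInstance
  haveI : ExpChar k' p := ExpChar.prime hp.out
  haveI : ExpChar κ p := ExpChar.prime hp.out
  haveI : PerfectRing k' p := PerfectField.toPerfectRing p
  let L : Subfield κ := ψ.fieldRange
  haveI : CharP L p := ((algebraMap L κ).charP_iff_charP p).mpr inferInstance
  haveI : ExpChar L p := ExpChar.prime hp.out
  haveI : PerfectRing L p := by
    refine PerfectRing.ofSurjective L p fun y => ?_
    obtain ⟨c, hc⟩ := ψ.mem_fieldRange.mp y.2
    obtain ⟨d, rfl⟩ := surjective_frobenius k' p c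
    refine ⟨⟨ψ d, ψ.mem_fieldRange.mpr ⟨d, rfl⟩⟩, Subtype.ext ?_⟩
    simp [frobenius_def, ← hc]
  haveI : PerfectField L := PerfectRing.toPerfectField L p
  haveI : Algebra.IsAlgebraic L κ := by
    refine ⟨fun xbar => ?_⟩
    obtain ⟨xO, rfl⟩ := Ideal.Quotient.mk_surjective (I := IsLocalRing.maximalIdeal O) xbar
    obtain ⟨f, hf0, hf⟩ := hzd (xO : K) xO.2
    have hcoe : ((Polynomial.eval₂ φ xO f : O) : K) = Polynomial.aeval (xO : K) f := by
      rw [show ((Polynomial.eval₂ φ xO f : O) : K) = O.subtype (Polynomial.eval₂ φ xO f) from rfl,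
        Polynomial.hom_eval₂, Polynomial.aeval_def]
      rfl
    have hroot : Polynomial.eval₂ ψ (IsLocalRing.residue O xO) f = 0 := by
      have h1 : Polynomial.eval₂ ψ (IsLocalRing.residue O xO) f =
          IsLocalRing.residue O (Polynomial.eval₂ φ xO f) := by
        rw [Polynomial.hom_eval₂]
      rw [h1, IsLocalRing.residue_eq_zero_iff, ValuationSubring.valuation_lt_one_iff, hcoe,
        ← ValuationSubring.mem_nonunits_iff]
      exact hf
    refine ⟨f.map ψ.rangeRestrictField, (Polynomial.map_ne_zero_iff ψ.rangeRestrictField.injective).mpr hf0,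
      ?_⟩
    rw [Polynomial.aeval_def, Polynomial.eval₂_map]
    exact hroot
  exact Algebra.IsAlgebraic.perfectField L

/-! ## The `t`-adic computation on `F(t)` -/

/-- If `Y ∈ F(t)` is `t`-integral and `Yⁿ ≡ a (mod t)` for a constant `a ∈ F`, then `a` is an `n`-th
power in `F` (namely `a = Y(0)ⁿ`). [folklore] -/
theorem exists_pow_eq_of_valuation_pow_sub_C_lt_one {F : Type} [Field F] (Y : RatFunc F) (a : F) (n : ℕ)
    (hY : (Polynomial.idealX F).valuation (RatFunc F) Y ≤ 1)
    (h : (Polynomial.idealX F).valuation (RatFunc F) (Y ^ n - RatFunc.C a) < 1) :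
    ∃ b : F, b ^ n = a := by
  have hd : Y.denom ≠ 0 := RatFunc.denom_ne_zero Y
  have hd' : algebraMap F[X] (RatFunc F) Y.denom ≠ 0 := RatFunc.algebraMap_ne_zero hd
  -- the denominator of a `t`-integral element is not divisible by `t`
  have hd0 : Y.denom.coeff 0 ≠ 0 := by
    intro h0
    have hXd : Polynomial.X ∣ Y.denom := Polynomial.X_dvd_iff.mpr h0
    have hvd : (Polynomial.idealX F).intValuation Y.denom < 1 :=
      (intValuation_lt_one_iff_mem _ _).mpr
        (by rw [Polynomial.idealX_span]; exact Ideal.mem_span_singleton.mpr hXd)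
    have hXn : ¬ Polynomial.X ∣ Y.num := by
      intro hXn
      obtain ⟨c, d, hcd⟩ := RatFunc.isCoprime_num_denom Y
      have : Polynomial.X ∣ (1 : F[X]) := hcd ▸ dvd_add (dvd_mul_of_dvd_right hXn c)
        (dvd_mul_of_dvd_right hXd d)
      exact Polynomial.not_isUnit_X (isUnit_of_dvd_one this)
    have hvn : (Polynomial.idealX F).intValuation Y.num = 1 :=
      intValuation_eq_one_iff.mpr
        (by rw [Polynomial.idealX_span]; exact fun h => hXn (Ideal.mem_span_singleton.mp h))
    have hvx : (Polynomial.idealX F).valuation (RatFunc F) Y =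
        1 / (Polynomial.idealX F).intValuation Y.denom := by
      conv_lhs => rw [← RatFunc.num_div_denom Y]
      rw [map_div₀, valuation_of_algebraMap, valuation_of_algebraMap, hvn]
    have hpos : 0 < (Polynomial.idealX F).intValuation Y.denom :=
      zero_lt_iff.mpr (intValuation_ne_zero _ _ hd)
    have : 1 < (Polynomial.idealX F).valuation (RatFunc F) Y := by
      rw [hvx, one_div, one_lt_inv₀ hpos]; exact hvd
    exact absurd hY (not_le.mpr this)
  have hvd : (Polynomial.idealX F).intValuation Y.denom = 1 :=
    intValuation_eq_one_iff.mpr (by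
      rw [Polynomial.idealX_span]
      exact fun h => hd0 (Polynomial.X_dvd_iff.mp (Ideal.mem_span_singleton.mp h)))
  -- `Yⁿ − a = N / denomⁿ` with `N = numⁿ − a·denomⁿ`
  set N : F[X] := Y.num ^ n - Polynomial.C a * Y.denom ^ n with hN
  have hY' : Y ^ n - RatFunc.C a =
      algebraMap F[X] (RatFunc F) N / algebraMap F[X] (RatFunc F) (Y.denom ^ n) := by
    conv_lhs => rw [← RatFunc.num_div_denom Y]
    rw [hN, map_sub, map_mul, map_pow, map_pow, RatFunc.algebraMap_C, div_pow, sub_div, mul_div_assoc,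
      div_self (pow_ne_zero _ hd'), mul_one]
  have hvN : (Polynomial.idealX F).intValuation N < 1 := by
    have h' := h
    rw [hY', map_div₀, valuation_of_algebraMap, valuation_of_algebraMap, map_pow, hvd, one_pow,
      div_one] at h'
    exact h'
  -- so `t ∣ N`, i.e. `N(0) = 0`
  have hXN : Polynomial.X ∣ N := by
    rw [intValuation_lt_one_iff_mem, Polynomial.idealX_span] at hvN
    exact Ideal.mem_span_singleton.mp hvN
  have hN0 : N.coeff 0 = 0 := Polynomial.X_dvd_iff.mp hXN
  rw [hN, Polynomial.coeff_zero_eq_eval_zero] at hN0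
  simp only [Polynomial.eval_sub, Polynomial.eval_mul, Polynomial.eval_pow, Polynomial.eval_C] at hN0
  refine ⟨Y.num.eval 0 / Y.denom.eval 0, ?_⟩
  have hd0' : Y.denom.eval 0 ≠ 0 := by rwa [← Polynomial.coeff_zero_eq_eval_zero]
  rw [div_pow, div_eq_iff (pow_ne_zero _ hd0'), ← sub_eq_zero]
  exact hN0

/-! ## The witness `K = 𝔽_p(s)(t)`, `O` the `t`-adic ring -/

section Witness

variable (p : ℕ) [hp : Fact p.Prime]

/-- Constants of `𝔽_p` lie in the `t`-adic valuation ring of `𝔽_p(s)(t)`. [folklore] -/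
theorem const_mem_tAdic (c : ZMod p) :
    algebraMap (ZMod p) (RatFunc (RatFunc (ZMod p))) c ∈
      ((Polynomial.idealX (RatFunc (ZMod p))).valuation (RatFunc (RatFunc (ZMod p)))).valuationSubring := by
  rw [Valuation.mem_valuationSubring_iff,
    IsScalarTower.algebraMap_apply (ZMod p) (RatFunc (ZMod p))[X] (RatFunc (RatFunc (ZMod p)))]
  exact valuation_le_one _ _

/-- `s = C X` lies in the `t`-adic valuation ring (it is a unit). [folklore] -/
theorem C_X_mem_tAdic :
    (RatFunc.C RatFunc.X : RatFunc (RatFunc (ZMod p))) ∈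
      ((Polynomial.idealX (RatFunc (ZMod p))).valuation (RatFunc (RatFunc (ZMod p)))).valuationSubring := by
  rw [Valuation.mem_valuationSubring_iff, ← RatFunc.algebraMap_C]
  exact valuation_le_one _ _

/-- `𝔽_p(s)(t)` is finitely generated over `𝔽_p`. [folklore] -/
theorem fg_top_ratFunc_ratFunc :
    (⊤ : IntermediateField (ZMod p) (RatFunc (RatFunc (ZMod p)))).FG := by
  haveI : IsScalarTower (ZMod p) (RatFunc (ZMod p)) (RatFunc (RatFunc (ZMod p))) :=
    IsScalarTower.of_algebraMap_eq fun c => by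
      rw [IsScalarTower.algebraMap_apply (ZMod p) (RatFunc (ZMod p))[X] (RatFunc (RatFunc (ZMod p))),
        Polynomial.algebraMap_apply, RatFunc.algebraMap_C, RatFunc.algebraMap_eq_C, RatFunc.algebraMap_eq_C]
  haveI h1 : Algebra.EssFiniteType (ZMod p) (RatFunc (ZMod p)) :=
    IntermediateField.fg_top_iff.mp ⟨{RatFunc.X}, by simp [RatFunc.adjoin_X]⟩
  haveI h2 : Algebra.EssFiniteType (RatFunc (ZMod p)) (RatFunc (RatFunc (ZMod p))) :=
    IntermediateField.fg_top_iff.mp ⟨{RatFunc.X}, by simp [RatFunc.adjoin_X]⟩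
  haveI : Algebra.EssFiniteType (ZMod p) (RatFunc (RatFunc (ZMod p))) :=
    Algebra.EssFiniteType.comp (ZMod p) (RatFunc (ZMod p)) (RatFunc (RatFunc (ZMod p)))
  exact IntermediateField.fg_top _ _

/-- The `t`-adic valuation ring of `𝔽_p(s)(t)` is rank one. [folklore] -/
theorem rankOne_tAdic :
    Nonempty ((Polynomial.idealX (RatFunc (ZMod p))).valuation
      (RatFunc (RatFunc (ZMod p)))).valuationSubring.valuation.RankOne := by
  set vX := (Polynomial.idealX (RatFunc (ZMod p))).valuation (RatFunc (RatFunc (ZMod p))) with hvX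
  have isEquiv_OX : vX.IsEquiv vX.valuationSubring.valuation :=
    Valuation.isEquiv_valuation_valuationSubring _
  haveI : vX.valuationSubring.valuation.IsNontrivial := by
    refine ⟨RatFunc.X, ?_, ?_⟩
    · simp [RatFunc.X_ne_zero]
    · intro h1
      have := (isEquiv_OX.symm.eq_one_iff_eq_one).mp h1
      rw [hvX, Polynomial.valuation_X_eq_neg_one] at this
      simp at this
  rw [Valuation.nonempty_rankOne_iff_mulArchimedean]
  haveI h1 : MulArchimedean (MonoidWithZeroHom.ValueGroup₀ (.ofClass vX)) :=
    MulArchimedean.comap MonoidWithZeroHom.ValueGroup₀.embedding.toMonoidHom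
      MonoidWithZeroHom.ValueGroup₀.embedding_strictMono
  exact MulArchimedean.comap (isEquiv_OX.symm.orderMonoidIso).toMonoidHom
    (isEquiv_OX.symm.orderMonoidIso).strictMono

/-- At the `t`-adic place of `𝔽_p(s)(t)`, no perfect subfield of the valuation ring has `s̄` algebraic over
its residue image. [folklore] -/
theorem not_exists_perfect_zeroDim_tAdic :
    ¬ ∃ k' : IntermediateField (ZMod p) (RatFunc (RatFunc (ZMod p))),
        (∀ c : k', (c : RatFunc (RatFunc (ZMod p))) ∈
          ((Polynomial.idealX (RatFunc (ZMod p))).valuation (RatFunc (RatFunc (ZMod p)))).valuationSubring) ∧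
        PerfectField k' ∧
        ∀ x ∈ ((Polynomial.idealX (RatFunc (ZMod p))).valuation (RatFunc (RatFunc (ZMod p)))).valuationSubring,
          ∃ f : Polynomial k', f ≠ 0 ∧ Polynomial.aeval x f ∈
            ((Polynomial.idealX (RatFunc (ZMod p))).valuation
              (RatFunc (RatFunc (ZMod p)))).valuationSubring.nonunits := by
  rintro ⟨k', hk', hperf, hzd⟩
  set vX := (Polynomial.idealX (RatFunc (ZMod p))).valuation (RatFunc (RatFunc (ZMod p))) with hvX
  haveI := hperf
  haveI : CharP (RatFunc (RatFunc (ZMod p))) p :=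
    charP_of_injective_algebraMap (algebraMap (ZMod p) (RatFunc (RatFunc (ZMod p)))).injective p
  obtain ⟨Y, hYO, hY⟩ := exists_pow_sub_mem_nonunits_of_perfect p vX.valuationSubring k' hk'
    (C_X_mem_tAdic p) (hzd _ (C_X_mem_tAdic p))
  rw [ValuationSubring.mem_nonunits_iff,
    ← (Valuation.isEquiv_valuation_valuationSubring vX).lt_one_iff_lt_one] at hY
  rw [Valuation.mem_valuationSubring_iff] at hYO
  obtain ⟨b, hb⟩ := exists_pow_eq_of_valuation_pow_sub_C_lt_one Y RatFunc.X p hYO hY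
  exact Literature.Barriers.ResolutionOfSingularities.ratFuncX_ne_pow p b hb

/-- **A rank-one instance of the conclusion outside the hypothesis.** The `t`-adic valuation ring of
`𝔽_p(s)(t)` lies in the range of the crux's conclusion (`k = 𝔽_p` perfect, `K` finitely generated,
`k ⊆ O`), IS rank one, and is NOT zero-dimensional over `k` (take `k' = ⊥ ≅ 𝔽_p`, a perfect field, in
`not_exists_perfect_zeroDim_tAdic`): a typed instance of the open DIMENSION HALF of the crux (rank one,
residue field `𝔽_p(s)` transcendental over `k`), complementing the trivial-valuation range lemma of
`Negative/ConclusionRangeExceedsHypothesis.lean`. [folklore] -/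
theorem exists_rankOne_conclusion_instance_not_zeroDim :
    ∃ (K : Type) (_ : Field K) (_ : Algebra (ZMod p) K) (O : ValuationSubring K),
      (⊤ : IntermediateField (ZMod p) K).FG ∧ (∀ c : ZMod p, algebraMap (ZMod p) K c ∈ O) ∧
        Nonempty O.valuation.RankOne ∧
        ¬ (∀ x ∈ O, ∃ f : Polynomial (ZMod p), f ≠ 0 ∧ Polynomial.aeval x f ∈ O.nonunits) := by
  refine ⟨RatFunc (RatFunc (ZMod p)), inferInstance, inferInstance, _, fg_top_ratFunc_ratFunc p,
    const_mem_tAdic p, rankOne_tAdic p, fun hzd => ?_⟩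
  refine not_exists_perfect_zeroDim_tAdic p ⟨⊥, fun c => ?_, ?_, fun x hx => ?_⟩
  · obtain ⟨a, ha⟩ := IntermediateField.mem_bot.mp c.2
    rw [← ha]
    exact const_mem_tAdic p a
  · haveI : Finite (⊥ : IntermediateField (ZMod p) (RatFunc (RatFunc (ZMod p)))) :=
      Finite.of_equiv (ZMod p) (IntermediateField.botEquiv (ZMod p) (RatFunc (RatFunc (ZMod p)))).symm
    exact PerfectField.ofFinite
  · obtain ⟨f, hf0, hf⟩ := hzd x hx
    refine ⟨f.map (algebraMap (ZMod p) (⊥ : IntermediateField (ZMod p) (RatFunc (RatFunc (ZMod p))))),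
      (Polynomial.map_ne_zero_iff (algebraMap (ZMod p) _).injective).mpr hf0, ?_⟩
    rwa [Polynomial.aeval_map_algebraMap]

end Witness

/-- **No perfect rebasing at rank-one places.** It is NOT the case that every RANK-ONE valuation ring
`O ⊇ k` of a finitely generated extension `K` of a perfect field `k` of characteristic `p` admits a perfect
intermediate ground field `k ⊆ k' ⊆ O` over which `O` is zero-dimensional.  Witness `p = 2`, `k = 𝔽₂`,
`K = 𝔽₂(s)(t)`, `O` the `t`-adic valuation ring (discrete, rank one, residue field `𝔽₂(s)`).  Hence the
hypothesis of `ResidueTranscendenceReduction` (rank-one zero-dimensional valuation rings over PERFECT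
fields) can never be applied to a positive-dimensional rank-one valuation ring of the same valued function
field after a change of ground field — Zariski's device C.IV §9 is unavailable inside the crux's frame.
[folklore] -/
theorem not_perfectRebase_rankOne :
    ¬ (∀ p : ℕ, p.Prime → ∀ (k K : Type) [Field k] [CharP k p] [PerfectField k] [Field K] [Algebra k K],
        (⊤ : IntermediateField k K).FG → ∀ O : ValuationSubring K, (∀ c : k, algebraMap k K c ∈ O) →
          Nonempty O.valuation.RankOne →
          ∃ k' : IntermediateField k K, (∀ c : k', (c : K) ∈ O) ∧ PerfectField k' ∧
            ∀ x ∈ O, ∃ f : Polynomial k', f ≠ 0 ∧ Polynomial.aeval x f ∈ O.nonunits) := by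
  intro h
  haveI : Fact (Nat.Prime 2) := ⟨Nat.prime_two⟩
  haveI : PerfectField (ZMod 2) := PerfectField.ofFinite
  exact not_exists_perfect_zeroDim_tAdic 2 (h 2 Nat.prime_two (ZMod 2) (RatFunc (RatFunc (ZMod 2)))
    (fg_top_ratFunc_ratFunc 2) _ (const_mem_tAdic 2) (rankOne_tAdic 2))


end RankOne

/-! ## §4c The general obstruction: perfect intermediate fields are algebraic

(mirrors `Theorems/ResidueTranscendenceReduction/Negative/ZeroDimOverPerfectRebase.lean`, landed p150917
`--supports` this crux.)  In characteristic `p`, a PERFECT intermediate field of a finitely generated extension `K/k` is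
algebraic over `k` (`General.isAlgebraic_of_perfectField_of_essFiniteType`); hence a valuation ring that is
zero-dimensional over some perfect `k' ⊆ O` is zero-dimensional over `k`
(`General.zeroDim_of_zeroDim_over_perfect`).  This is the theorem behind both witnesses of §4/§4b: NO
admissible change of ground field inside `K` brings a positive-dimensional `O` into the range of `HypA`. -/

namespace General

open Polynomial

/-- Total degree of a power over a domain. [folklore] -/
theorem totalDegree_pow_of_isDomain {σ R : Type} [CommRing R] [IsDomain R] {f : MvPolynomial σ R}
    (hf : f ≠ 0) (n : ℕ) : (f ^ n).totalDegree = n * f.totalDegree := by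
  induction n with
  | zero => simp
  | succ n ih =>
    rw [pow_succ, MvPolynomial.totalDegree_mul_of_isDomain (pow_ne_zero n hf) hf, ih]
    ring

/-- A variable of `k[X_σ]` is not a `p`-th power in the rational function field `Frac k[X_σ]` (`p ≥ 2`):
total-degree count `p · deg a = 1 + p · deg b`. [folklore] -/
theorem pow_ne_X_fractionRing {k σ : Type} [Field k] (i : σ) {p : ℕ} (hp : 2 ≤ p)
    (z : FractionRing (MvPolynomial σ k)) :
    z ^ p ≠ algebraMap (MvPolynomial σ k) (FractionRing (MvPolynomial σ k)) (MvPolynomial.X i) := by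
  intro hz
  obtain ⟨a, b, hb, rfl⟩ := IsFractionRing.div_surjective (A := MvPolynomial σ k) z
  have hb0 : b ≠ 0 := nonZeroDivisors.ne_zero hb
  have hb' : algebraMap (MvPolynomial σ k) (FractionRing (MvPolynomial σ k)) b ≠ 0 :=
    IsFractionRing.to_map_ne_zero_of_mem_nonZeroDivisors hb
  rw [div_pow, div_eq_iff (pow_ne_zero _ hb'), ← map_pow, ← map_pow, ← map_mul,
    (IsFractionRing.injective (MvPolynomial σ k) (FractionRing (MvPolynomial σ k))).eq_iff] at hz
  -- hz : a ^ p = X i * b ^ p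
  have ha0 : a ≠ 0 := by
    rintro rfl
    rw [zero_pow (by omega), eq_comm, mul_eq_zero] at hz
    rcases hz with h | h
    · exact MvPolynomial.X_ne_zero i h
    · exact pow_ne_zero _ hb0 h
  have hdeg := congrArg MvPolynomial.totalDegree hz
  rw [totalDegree_pow_of_isDomain ha0,
    MvPolynomial.totalDegree_mul_of_isDomain (MvPolynomial.X_ne_zero i) (pow_ne_zero _ hb0),
    totalDegree_pow_of_isDomain hb0, MvPolynomial.totalDegree_X] at hdeg
  have h2 : p ∣ 1 + p * b.totalDegree := hdeg ▸ dvd_mul_right p a.totalDegree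
  have h3 : p ∣ 1 := (Nat.dvd_add_left (dvd_mul_right p b.totalDegree)).mp h2
  have := Nat.le_of_dvd one_pos h3
  omega

/-- An element of an algebraically independent family is not a `p`-th power in the field it generates
(`p ≥ 2`). [folklore] -/
theorem pow_ne_of_algebraicIndependent {k K ι : Type} [Field k] [Field K] [Algebra k K] {x : ι → K}
    (hx : AlgebraicIndependent k x) (i : ι) {p : ℕ} (hp : 2 ≤ p)
    (v : IntermediateField.adjoin k (Set.range x)) : (v : K) ^ p ≠ x i := by
  intro hv
  apply pow_ne_X_fractionRing i hp (hx.aevalEquivField.symm v)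
  apply hx.aevalEquivField.injective
  apply Subtype.ext
  rw [map_pow, AlgEquiv.apply_symm_apply, hx.aevalEquivField_algebraMap_apply_coe, MvPolynomial.aeval_X]
  push_cast
  exact hv

/-- **A perfect intermediate field of a finitely generated extension is algebraic over the base**
(characteristic `p`; the base need not be perfect). [folklore] -/
theorem isAlgebraic_of_perfectField_of_essFiniteType {k K : Type} [Field k] [Field K] [Algebra k K]
    (p : ℕ) [hp : Fact p.Prime] [CharP k p] [Algebra.EssFiniteType k K]
    (k' : IntermediateField k K) [PerfectField k'] : Algebra.IsAlgebraic k k' := by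
  classical
  haveI : CharP K p := charP_of_injective_algebraMap (algebraMap k K).injective p
  haveI : CharP k' p := ((algebraMap k' K).charP_iff_charP p).mpr inferInstance
  haveI : ExpChar k' p := ExpChar.prime hp.out
  haveI : PerfectRing k' p := PerfectField.toPerfectRing p
  rw [Algebra.isAlgebraic_def]
  by_contra hnot
  obtain ⟨u, hu⟩ := not_forall.mp hnot
  have huK : Transcendental k (u : K) :=
    (transcendental_algebraMap_iff (algebraMap k' K).injective).mpr hu
  -- a transcendence basis of `K/k` through `u`
  have hind : AlgebraicIndepOn k id ({(u : K)} : Set K) :=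
    (algebraicIndependent_singleton_iff (⟨(u : K), Set.mem_singleton _⟩ : ({(u : K)} : Set K))).mpr huK
  obtain ⟨T, huT, hT⟩ := exists_isTranscendenceBasis_superset hind
  have huT' : (u : K) ∈ T := huT (Set.mem_singleton _)
  set F : IntermediateField k K := IntermediateField.adjoin k (Set.range ((↑) : T → K)) with hF
  haveI : Algebra.IsAlgebraic F K := hT.isAlgebraic_field
  haveI : Algebra.EssFiniteType F K := Algebra.EssFiniteType.of_comp k F K
  haveI : Module.Finite F K := Algebra.finite_of_essFiniteType_of_isAlgebraic (F := F) (E := K)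
  haveI : CharP F p := ((algebraMap F K).charP_iff_charP p).mpr inferInstance
  haveI : ExpChar F p := ExpChar.prime hp.out
  have huF : (u : K) ∈ F := IntermediateField.subset_adjoin k _ ⟨⟨(u : K), huT'⟩, rfl⟩
  -- `pⁿ > [K : F]` and a `pⁿ`-th root `w ∈ k'` of `u`
  obtain ⟨n, hn⟩ : ∃ n : ℕ, Module.finrank F K < p ^ n := ⟨_, Nat.lt_pow_self hp.out.one_lt⟩
  obtain ⟨w, hw⟩ := (iterateFrobeniusEquiv k' p n).surjective u
  have hwK : ((w : k') : K) ^ p ^ n = (u : K) := by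
    rw [← hw, coe_iterateFrobeniusEquiv, iterateFrobenius_def]
    push_cast
    rfl
  -- the minimal polynomial of `w` over `F` is `X^{p^m} − y`
  have hsep : (minpoly F ((w : k') : K)).natSepDegree = 1 :=
    (minpoly.natSepDegree_eq_one_iff_pow_mem p).mpr ⟨n, ⟨⟨(u : K), huF⟩, hwK.symm⟩⟩
  obtain ⟨m, y, hmin⟩ := (minpoly.natSepDegree_eq_one_iff_eq_X_pow_sub_C p).mp hsep
  have hwm : ((w : k') : K) ^ p ^ m = algebraMap F K y := by
    have h0 := minpoly.aeval F ((w : k') : K)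
    rw [hmin] at h0
    simpa [sub_eq_zero] using h0
  by_cases hmn : m < n
  · -- then `F = k(T)` contains a `p`-th root of the variable `u`
    have hroot : ((y ^ p ^ (n - m - 1) : F) : K) ^ p = (u : K) := by
      push_cast
      rw [show ((y : F) : K) = algebraMap F K y from rfl, ← hwm, ← pow_mul, ← pow_mul, ← hwK]
      congr 1
      rw [← pow_succ, ← pow_add]
      congr 1
      omega
    exact pow_ne_of_algebraicIndependent hT.1 ⟨(u : K), huT'⟩ hp.out.two_le _ hroot
  · -- otherwise the degree of `w` over `F` exceeds `[K : F]`
    have hdeg : (minpoly F ((w : k') : K)).natDegree = p ^ m := by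
      rw [hmin, natDegree_X_pow_sub_C]
    have hle := minpoly.natDegree_le (A := F) ((w : k') : K)
    have hpow : p ^ n ≤ p ^ m := Nat.pow_le_pow_right hp.out.pos (not_lt.mp hmn)
    omega

/-- **Rebasing to a perfect intermediate field never lowers the residue dimension.** For a finitely
generated extension `K/k` in characteristic `p` and a valuation ring `O` of `K` containing `k`: if `O` is
zero-dimensional over some PERFECT intermediate field `k' ⊆ O` (every `x ∈ O` satisfies `f(x) ∈ 𝔪_O` for a
non-zero `f ∈ k'[X]`), then `O` is already zero-dimensional over `k`.  Hence the hypothesis `HypA` of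
`ResidueTranscendenceReduction` is applicable to `(k', K, O)` for some admissible `k'` only when it is
applicable to `(k, K, O)` itself (given rank one): the dimension half cannot be reached inside `K`. [folklore] -/
theorem zeroDim_of_zeroDim_over_perfect {k K : Type} [Field k] [Field K] [Algebra k K]
    (p : ℕ) [hp : Fact p.Prime] [CharP k p] (hfg : (⊤ : IntermediateField k K).FG)
    (O : ValuationSubring K) (k' : IntermediateField k K) (hk' : ∀ c : k', (c : K) ∈ O) [PerfectField k']
    (hzd : ∀ x ∈ O, ∃ f : Polynomial k', f ≠ 0 ∧ Polynomial.aeval x f ∈ O.nonunits) :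
    ∀ x ∈ O, ∃ f : Polynomial k, f ≠ 0 ∧ Polynomial.aeval x f ∈ O.nonunits := by
  classical
  haveI : Algebra.EssFiniteType k K := IntermediateField.fg_top_iff.mp hfg
  haveI : Algebra.IsAlgebraic k k' := isAlgebraic_of_perfectField_of_essFiniteType p k'
  intro x hx
  obtain ⟨f, hf0, hf⟩ := hzd x hx
  -- work in the residue field: `x̄` is a root of `f̄ ≠ 0`, whose coefficients are algebraic over `k`
  let φ : k' →+* O := (algebraMap k' K).codRestrict O (fun c => hk' c)
  let κ := IsLocalRing.ResidueField O
  let ψ : k' →+* κ := (IsLocalRing.residue O).comp φ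
  -- `k → O → κ`
  have hk : ∀ c : k, algebraMap k K c ∈ O := fun c => by
    simpa using hk' (algebraMap k k' c)
  let φ₀ : k →+* O := (algebraMap k K).codRestrict O hk
  let ψ₀ : k →+* κ := (IsLocalRing.residue O).comp φ₀
  letI : Algebra k κ := ψ₀.toAlgebra
  letI : Algebra k' κ := ψ.toAlgebra
  haveI : IsScalarTower k k' κ := IsScalarTower.of_algebraMap_eq fun c => rfl
  let xO : O := ⟨x, hx⟩
  let xbar : κ := IsLocalRing.residue O xO
  -- `x̄` algebraic over `k'`
  have hcoe : ((Polynomial.eval₂ φ xO f : O) : K) = Polynomial.aeval x f := by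
    rw [show ((Polynomial.eval₂ φ xO f : O) : K) = O.subtype (Polynomial.eval₂ φ xO f) from rfl,
      Polynomial.hom_eval₂, Polynomial.aeval_def]
    rfl
  have hroot : Polynomial.aeval xbar f = 0 := by
    rw [Polynomial.aeval_def, show algebraMap k' κ = ψ from rfl]
    have h1 : Polynomial.eval₂ ψ xbar f = IsLocalRing.residue O (Polynomial.eval₂ φ xO f) := by
      rw [Polynomial.hom_eval₂]
    rw [h1, IsLocalRing.residue_eq_zero_iff, ValuationSubring.valuation_lt_one_iff, hcoe,
      ← ValuationSubring.mem_nonunits_iff]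
    exact hf
  have halg' : IsAlgebraic k' xbar := ⟨f, hf0, hroot⟩
  -- hence algebraic over `k`
  have halg : IsAlgebraic k xbar := IsAlgebraic.restrictScalars k halg'
  obtain ⟨g, hg0, hg⟩ := halg
  refine ⟨g, hg0, ?_⟩
  -- pull `g(x̄) = 0` back to `g(x) ∈ 𝔪_O`
  have hcoe0 : ((Polynomial.eval₂ φ₀ xO g : O) : K) = Polynomial.aeval x g := by
    rw [show ((Polynomial.eval₂ φ₀ xO g : O) : K) = O.subtype (Polynomial.eval₂ φ₀ xO g) from rfl,
      Polynomial.hom_eval₂, Polynomial.aeval_def]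
    rfl
  rw [Polynomial.aeval_def, show algebraMap k κ = ψ₀ from rfl] at hg
  have h1 : Polynomial.eval₂ ψ₀ xbar g = IsLocalRing.residue O (Polynomial.eval₂ φ₀ xO g) := by
    rw [Polynomial.hom_eval₂]
  rw [h1, IsLocalRing.residue_eq_zero_iff, ValuationSubring.valuation_lt_one_iff, hcoe0,
    ← ValuationSubring.mem_nonunits_iff] at hg
  exact hg


end General

/-! ## §5 Why it resists (informal record for the provers)

* `HypA p` is open from transcendence degree 4 on (it is local uniformization at the "essential"
  valuations, Cutkosky–Mourtada 2019 §1); `ConcB p` follows from the summit (§1).  No small or finite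
  model exists: both halves quantify over all finitely generated fields.
* Devices that would reduce `ConcB` to `HypA` and their fate:
  (i) Zariski's ground-field extension `k' = k(ξ)` — leaves perfect fields (§4, `not_perfectRebase`);
  (ii) composite with a zero-dimensional valuation of the residue field — raises the rank, and
  `NovacoskiSpivakovsky2014_holds` (tree) hands back the original positive-dimensional rank-one piece;
  (iii) perfect-closure rebasing `k'' = k(u)^{perf}`, `K'' = K(u^{1/p^∞})`, `u ↦ ξ + t` (Gauss-type
  extension with `v(t) > 0`): `HypA` applies to `(k'', K'', O'')`, the regular model is defined over
  some `k(u^{1/pⁿ})`, flat descent (`IsRegularLocalRing.of_flat_of_isLocalHom`, tree) brings regularity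
  down to `K(u^{1/pⁿ}) = K(τ)`, a simple transcendental extension of `K` carrying a NON-Gauss extension of
  `O` (residue field `Δ(ξ̄^{1/pⁿ})`); the last step `K(τ) ⇝ K` is a specialisation of a regular
  `k(τ)`-variety that is not geometrically regular in general — catalogued barrier
  `Literature.Barriers.ResolutionOfSingularities.InseparableBaseChange(Resolution)`.
* COSTUME CHECK of the in-field rebase (iii'): `k₁ = k(y)^{perf}` with `y ∈ O` lifts of a residue transcendence
  basis, `K₁ = K(y^{1/p^∞})` (purely inseparable over `K`, f.g. over the perfect `k₁`, `O₁` the unique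
  extension: rank one, zero-dimensional over `k₁`).  `HypA` at `(k₁, K₁, O₁)` plus flat descent yields a regular
  model of `K(y^{1/pⁿ})` for SOME `n` depending on `R` — an INSEPARABLE local uniformization at `O` of the
  special shape "adjoin `pⁿ`-th roots of residue-transcendental units", the kind of statement Temkin 2013
  Thm 1.3.2 already provides unconditionally for some purely inseparable `L/K` (tree named facts `Temkin2013`,
  `Temkin2013HeightLeOne`).  What is left is "LU descends from `K(y^{1/pⁿ})` to `K` at a rank-one place": its
  GENERAL form (descent along arbitrary finite purely inseparable `L/K`) composed with Temkin's theorem would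
  prove LU at every valuation outright, so only the SPECIAL form (roots of residue-transcendental units; idea
  card `relative-frobenius-descent`) can be easier than LU itself — planners should keep the residual that
  narrow (warning recorded here; not a refutation).
* Dropping `PerfectField k` from `HypA` turns the crux into Zariski's device + NS2014 (a theorem); the
  planner kept `PerfectField` because the engine `ZariskiCMEngine` outputs LU over perfect fields only.
* In print (read this cycle, arXiv:0804.1554 = Temkin 2013, pp. 29 and 38): the only treatment of the
  residue-transcendence aspect of LU in characteristic `p` is Temkin's Thm 4.1.1 — induction on the defect rank
  `D_{K/k}` for height-one valued fields over an ARBITRARY trivially valued `k`, paying with finite purely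
  inseparable extensions `l/k` of the GROUND FIELD and `L/lK` of the function field; Cor. 5.2.7 rebases to
  `k(B_F) ⊆ K` (Zariski's device) precisely because his theorem quantifies over imperfect `k`.  Rank is reduced
  separately (NS2014, arXiv:1204.4751; survey arXiv:1509.06350 §3, read: category-based, rank only).  So no
  printed argument produces `HypA → ConcB` with `HypA` confined to perfect ground fields; searches this cycle
  were degraded (hub searchd down, OpenAlex/S2/arXiv HTTP 429) — `search-degraded`, not evidence of absence.
-/

end Summit.ResolutionOfSingularities.ResolutionOfSingularities.Cruxes.ResidueTranscendenceReduction.Disproof
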